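import Summits.ValiantsHypothesis.ValiantsHypothesis.Theorems.KPlusLogSqLawTropicalBAffineDualSector

/-!
# Route «KPlusLogSqLaw», crux `TropicalB` (stmt-ValiantsHypothesis-19771) — the AFFINE-DUAL SECTOR LAW, part 2:
# PIECEWISE-affine certificates — `P` affine pieces give `n + 1 ≤ P·(K·m² − m + 1)`

HONEST FRAMING.  Helper (`--supports stmt-ValiantsHypothesis-19771`, def-free), continuation of `…TropicalBAffineDualSector` (same seat):
the quantitative form of that file's located reading «beyond `K·m² − m` steps the row potentials must bend».  A SECTOR theorem about
dominant chains of ARBITRARY dominance designs under a certificate-class hypothesis; it bounds nothing for `TropicalB` in its window and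
asserts nothing about `TropicalB`, `Lifting` (stmt-ValiantsHypothesis-19772), `WeakLifting` (stmt-ValiantsHypothesis-19561), `KPlusLogSqLaw`,
`MatrixDescartes` (stmt-ValiantsHypothesis-18050) or `VP ≠ VNP`.

THE LAW.  Let `p₀, …, pₙ` be unique optima of a design `(d, v, ε)` of format `(m, K)` at strictly increasing integer slopes `θₖ`, consecutive
terms distinct.  Suppose the chain is cut into consecutive PIECES by a monotone label `piece : Fin (n+1) → ℕ` with values `< P`, and on each
piece ONE affine row gauge certifies column-wise: for every `k`, column `b` and present incidence `(a, b, l)`,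
  `S·(θₖ·d l − v a b l) + (θₖ·x_{piece k} a − y_{piece k} a) ≤ (the same for pₖ's incidence in column b)`
(scale `S > 0` common, gauges `x j`, potentials `y j` per piece `j`).  Then

* `le_of_samePiece` — bookkeeping: a sequence that does not decrease across the steps INSIDE a piece is monotone on every piece;
* `pieceStep_le` / `exists_pieceStep_lt` — inside a piece the gauged slope `S·d (λₖ b) + x_{piece} (σₖ b)` of every column does not
  decrease, and some column's rises strictly (part 1's `gaugedSlope_mono` and the weight-tie argument, per step);
* `chain_le_of_piecewiseAffineCert_card` — **`n + 1 ≤ P·(m·(C − 1) + 1)`** whenever every gauge's slope set `{S·d l + x j a}` lies in a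
  finite `T j` with `#T j ≤ C`: the `≤ P − 1` piece changes are free, and inside the pieces every column rises strictly at most `C − 1`
  times per piece;
* `chain_le_of_piecewiseAffineCert` — **`n + 1 ≤ P·(K·m² − m + 1)`** (`C = m·K`); `P = 1` is part 1's `n + m ≤ K·m²`.

READING (located, nothing asserted).  Rotation-PHASE designs certified with one affine gauge per phase (SHIFT-THREE uses one gauge for ALL
phases; GRW-lite's type-D certificate `UD a = g·θ·a + muD(…)` re-bends at every state) are priced by the NUMBER OF PIECES: a cubic `(m, 4)`
family needs `P ≥ (n+1)/(4m² − m + 1) = Ω(m)` affinely-certified pieces, the staircase's `m^{(K−2)/2}` chains need `m^{(K−2)/2}/(K m²)`, and a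
`2^{CK}`-chain at `m = K⌊log₂ K⌋` (the shape of `stub_tropTowerLog`) needs `2^{CK}/(K³⌊log₂K⌋² + 1)` pieces — growth must be carried by
re-gauging, never by the work inside a gauge.  [folklore: LP duality for the assignment polytope; elementary counting]
-/

set_option linter.dupNamespace false
set_option autoImplicit false

namespace Summit.ValiantsHypothesis.ValiantsHypothesis.Theorems.KPlusLogSqLaw

open Summit.ValiantsHypothesis.ValiantsHypothesis.Theorems.MatrixDescartes.Negative
open Summit.ValiantsHypothesis.ValiantsHypothesis.Theorems.LacunarySymmetroidMatrixDescartes.TropicalCensus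
  (present_of_termSign_ne_zero)
open scoped BigOperators
open Finset

namespace AffineDual

/-- **monotone on pieces**: if `piece` is monotone and `f` does not decrease across any step inside a piece, then `f i ≤ f i'` whenever
`i ≤ i'` lie in the same piece. [folklore] -/
theorem le_of_samePiece {n : ℕ} (f : Fin (n + 1) → ℤ) (piece : Fin (n + 1) → ℕ) (hpm : Monotone piece)
    (hstep : ∀ k : Fin n, piece k.castSucc = piece k.succ → f k.castSucc ≤ f k.succ)
    (i i' : Fin (n + 1)) (hii' : i ≤ i') (hp : piece i = piece i') : f i ≤ f i' := by
  have hle : (i : ℕ) ≤ (i' : ℕ) := Fin.le_def.mp hii'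
  obtain ⟨g, hg⟩ : ∃ g : ℕ, (i' : ℕ) = i + g := ⟨i' - i, by omega⟩
  induction g generalizing i' with
  | zero =>
    have : i' = i := Fin.ext (by omega)
    rw [this]
  | succ g ih =>
    have hlt : (i : ℕ) + g < n + 1 := by have := i'.isLt; omega
    have hkn : (i : ℕ) + g < n := by have := i'.isLt; omega
    -- the intermediate index `i + g` and the step from it to `i'`
    set k : Fin n := ⟨i + g, hkn⟩ with hk
    have hkc : (k.castSucc : ℕ) = i + g := by simp [hk]
    have hks : k.succ = i' := Fin.ext (by simp [hk]; omega)
    have h1 : i ≤ k.castSucc := Fin.le_def.mpr (by rw [hkc]; omega)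
    have h2 : k.castSucc ≤ i' := Fin.le_def.mpr (by rw [hkc]; omega)
    have hp1 : piece i = piece k.castSucc := le_antisymm (hpm h1) (by rw [hp]; exact hpm h2)
    have hp2 : piece k.castSucc = piece k.succ := by rw [hks, ← hp1, hp]
    have ih' := ih k.castSucc h1 hp1 (by rw [hkc]; exact Nat.le_add_right _ _) hkc
    have hst := hstep k hp2
    rw [hks] at hst
    exact ih'.trans hst

variable {m K : ℕ} (d : Fin K → ℕ) (v ε : Fin m → Fin m → Fin K → ℤ)

section Pieces

variable (S : ℤ) (P : ℕ) (x y : ℕ → Fin m → ℤ) {n : ℕ} (θ : Fin (n + 1) → ℤ)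
  (p : Fin (n + 1) → Equiv.Perm (Fin m) × (Fin m → Fin K)) (piece : Fin (n + 1) → ℕ)
  (hS : 0 < S) (hθ : StrictMono θ) (hdom : ∀ k, IsDominant d v ε (θ k) (p k))
  (hne : ∀ k : Fin n, p k.castSucc ≠ p k.succ) (hP : ∀ k, piece k < P) (hpm : Monotone piece)
  (hcert : ∀ (k : Fin (n + 1)) (b a : Fin m) (l : Fin K), ε a b l ≠ 0 →
    S * (θ k * (d l : ℤ) - v a b l) + (θ k * x (piece k) a - y (piece k) a) ≤
      S * (θ k * (d ((p k).2 b) : ℤ) - v ((p k).1 b) b ((p k).2 b)) +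
        (θ k * x (piece k) ((p k).1 b) - y (piece k) ((p k).1 b)))
include hθ hdom hcert

/-- inside a piece the gauged slope of every column does not decrease (part 1's `gaugedSlope_mono` with the piece's gauge). -/
theorem pieceStep_le (k : Fin n) (hk : piece k.castSucc = piece k.succ) (b : Fin m) :
    S * (d ((p k.castSucc).2 b) : ℤ) + x (piece k.castSucc) ((p k.castSucc).1 b) ≤
      S * (d ((p k.succ).2 b) : ℤ) + x (piece k.castSucc) ((p k.succ).1 b) := by
  have h₁ := hcert k.castSucc b _ _ (present_of_termSign_ne_zero ε _ (hdom k.succ).1 b)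
  have h₂ := hcert k.succ b _ _ (present_of_termSign_ne_zero ε _ (hdom k.castSucc).1 b)
  rw [← hk] at h₂
  exact gaugedSlope_mono d v S (x (piece k.castSucc)) (y (piece k.castSucc)) θ p hθ k b h₁ h₂

include hS hne

/-- inside a piece some column's gauged slope rises strictly at every step (the weight-tie argument of part 1, per step). -/
theorem exists_pieceStep_lt (k : Fin n) (hk : piece k.castSucc = piece k.succ) :
    ∃ b : Fin m, S * (d ((p k.castSucc).2 b) : ℤ) + x (piece k.castSucc) ((p k.castSucc).1 b) <
      S * (d ((p k.succ).2 b) : ℤ) + x (piece k.castSucc) ((p k.succ).1 b) := by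
  by_contra hno
  simp only [not_exists, not_lt] at hno
  set j := piece k.castSucc with hj
  have hlt : θ k.castSucc < θ k.succ := hθ Fin.castSucc_lt_succ
  have hcol : ∀ b : Fin m,
      S * (θ k.castSucc * (d ((p k.succ).2 b) : ℤ) - v ((p k.succ).1 b) b ((p k.succ).2 b)) +
          (θ k.castSucc * x j ((p k.succ).1 b) - y j ((p k.succ).1 b)) =
        S * (θ k.castSucc * (d ((p k.castSucc).2 b) : ℤ) - v ((p k.castSucc).1 b) b ((p k.castSucc).2 b)) +
          (θ k.castSucc * x j ((p k.castSucc).1 b) - y j ((p k.castSucc).1 b)) := by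
    intro b
    have hle := pieceStep_le d v ε S x y θ p piece hθ hdom hcert k hk b
    have heq : S * (d ((p k.castSucc).2 b) : ℤ) + x j ((p k.castSucc).1 b) =
        S * (d ((p k.succ).2 b) : ℤ) + x j ((p k.succ).1 b) := le_antisymm hle (hno b)
    have h₁ := hcert k.castSucc b _ _ (present_of_termSign_ne_zero ε _ (hdom k.succ).1 b)
    have h₂ := hcert k.succ b _ _ (present_of_termSign_ne_zero ε _ (hdom k.castSucc).1 b)
    rw [← hk] at h₂
    have e₁ : S * v ((p k.castSucc).1 b) b ((p k.castSucc).2 b) + y j ((p k.castSucc).1 b) ≤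
        S * v ((p k.succ).1 b) b ((p k.succ).2 b) + y j ((p k.succ).1 b) := by
      linear_combination h₁ + θ k.castSucc * heq
    have e₂ : S * v ((p k.succ).1 b) b ((p k.succ).2 b) + y j ((p k.succ).1 b) ≤
        S * v ((p k.castSucc).1 b) b ((p k.castSucc).2 b) + y j ((p k.castSucc).1 b) := by
      linear_combination h₂ - θ k.succ * heq
    linear_combination (-θ k.castSucc) * heq + (le_antisymm e₁ e₂)
  have hsum := Finset.sum_congr rfl fun b (_ : b ∈ (univ : Finset (Fin m))) => hcol b
  rw [sum_gaugedScore d v S (x j) (y j), sum_gaugedScore d v S (x j) (y j)] at hsum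
  have hw : tropWeight d v (θ k.castSucc) (p k.succ) < tropWeight d v (θ k.castSucc) (p k.castSucc) :=
    (hdom k.castSucc).2 _ (hne k).symm (hdom k.succ).1
  have : S * tropWeight d v (θ k.castSucc) (p k.succ) < S * tropWeight d v (θ k.castSucc) (p k.castSucc) :=
    mul_lt_mul_of_pos_left hw hS
  linarith

include hP hpm

/-- **PIECEWISE AFFINE-DUAL LAW (cardinality form): `n + 1 ≤ P·(m·(C − 1) + 1)`.**  The `≤ P − 1` steps at which the piece changes are free;
inside the pieces every step is paid by a strict rise of some column's gauged slope, and per column and piece a non-decreasing `T j`-valued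
sequence rises strictly at most `#T j − 1 ≤ C − 1` times. [folklore] -/
theorem chain_le_of_piecewiseAffineCert_card (C : ℕ) (T : ℕ → Finset ℤ)
    (hT : ∀ (j : ℕ) (a : Fin m) (l : Fin K), S * (d l : ℤ) + x j a ∈ T j) (hC : ∀ j, (T j).card ≤ C) :
    n + 1 ≤ P * (m * (C - 1) + 1) := by
  classical
  -- gauged slope of column `b` at index `k`, in the gauge of its own piece
  set f : Fin m → Fin (n + 1) → ℤ := fun b k => S * (d ((p k).2 b) : ℤ) + x (piece k) ((p k).1 b) with hf
  have hstep : ∀ b (k : Fin n), piece k.castSucc = piece k.succ → f b k.castSucc ≤ f b k.succ := by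
    intro b k hk
    have := pieceStep_le d v ε S x y θ p piece hθ hdom hcert k hk b
    simp only [hf]; rw [← hk]; exact this
  have hmono : ∀ b (i i' : Fin (n + 1)), i ≤ i' → piece i = piece i' → f b i ≤ f b i' :=
    fun b => le_of_samePiece (f b) piece hpm (hstep b)
  have hmem : ∀ b k, f b k ∈ T (piece k) := fun b k => hT _ _ _
  have hP0 : 0 < P := lt_of_le_of_lt (Nat.zero_le _) (hP 0)
  -- within-steps and cross-steps
  set W : Finset (Fin n) := univ.filter fun k => piece k.castSucc = piece k.succ with hW
  set X : Finset (Fin n) := univ.filter fun k => piece k.castSucc ≠ piece k.succ with hX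
  have hWX : W.card + X.card = n := by
    rw [hW, hX, Finset.card_filter_add_card_filter_not, card_univ, Fintype.card_fin]
  -- (a) cross steps: at most `P − 1`
  have hXle : X.card + 1 ≤ P := by
    have hle : X.card ≤ ((range P).erase (piece 0)).card := by
      refine card_le_card_of_injOn (fun k : Fin n => piece k.succ) (fun k hk => ?_) (fun k hk k' hk' hkk' => ?_)
      · have hkx : piece k.castSucc ≠ piece k.succ := (mem_filter.mp (mem_coe.mp hk)).2
        have hlt : piece k.castSucc < piece k.succ := lt_of_le_of_ne (hpm (Fin.castSucc_lt_succ).le) hkx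
        have h0 : piece 0 ≤ piece k.castSucc := hpm (Fin.zero_le _)
        have hne0 : piece k.succ ≠ piece 0 := by omega
        exact mem_coe.mpr (mem_erase.mpr ⟨hne0, mem_range.mpr (hP _)⟩)
      · have e : piece k.succ = piece k'.succ := hkk'
        have hkx : piece k.castSucc < piece k.succ :=
          lt_of_le_of_ne (hpm (Fin.castSucc_lt_succ).le) (mem_filter.mp (mem_coe.mp hk)).2
        have hkx' : piece k'.castSucc < piece k'.succ :=
          lt_of_le_of_ne (hpm (Fin.castSucc_lt_succ).le) (mem_filter.mp (mem_coe.mp hk')).2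
        by_contra hne'
        rcases lt_or_gt_of_ne hne' with hlt | hlt
        · have hv : (k : ℕ) < (k' : ℕ) := Fin.lt_def.mp hlt
          have h1 : piece k.succ ≤ piece k'.castSucc := hpm (by
            rw [Fin.le_iff_val_le_val]; simp only [Fin.val_succ, Fin.val_castSucc]; omega)
          omega
        · have hv : (k' : ℕ) < (k : ℕ) := Fin.lt_def.mp hlt
          have h1 : piece k'.succ ≤ piece k.castSucc := hpm (by
            rw [Fin.le_iff_val_le_val]; simp only [Fin.val_succ, Fin.val_castSucc]; omega)
          omega
    have h0 : piece 0 ∈ range P := mem_range.mpr (hP 0)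
    have := card_erase_of_mem h0
    have hr : (range P).card = P := card_range P
    omega
  -- (b) within steps: each is paid by a strict rise of some column inside its piece
  obtain ⟨R, hR⟩ : ∃ R : Fin m → ℕ → ℕ, ∀ b j, R b j =
      (univ.filter fun k : Fin n =>
        piece k.castSucc = piece k.succ ∧ piece k.castSucc = j ∧ f b k.castSucc < f b k.succ).card :=
    ⟨_, fun _ _ => rfl⟩
  have hWle : W.card ≤ ∑ b : Fin m, ∑ j ∈ range P, R b j := by
    -- rewrite the double sum as a sum over steps
    have h1 : ∑ b : Fin m, ∑ j ∈ range P, R b j =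
        ∑ k : Fin n, ∑ b : Fin m, ∑ j ∈ range P,
          (if piece k.castSucc = piece k.succ ∧ piece k.castSucc = j ∧ f b k.castSucc < f b k.succ then 1 else 0) := by
      calc ∑ b : Fin m, ∑ j ∈ range P, R b j
          = ∑ b : Fin m, ∑ j ∈ range P, ∑ k : Fin n,
              (if piece k.castSucc = piece k.succ ∧ piece k.castSucc = j ∧ f b k.castSucc < f b k.succ then 1 else 0) := by
            refine sum_congr rfl fun b _ => sum_congr rfl fun j _ => ?_
            rw [hR]; exact card_filter _ _
        _ = ∑ b : Fin m, ∑ k : Fin n, ∑ j ∈ range P,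
              (if piece k.castSucc = piece k.succ ∧ piece k.castSucc = j ∧ f b k.castSucc < f b k.succ then 1 else 0) :=
            sum_congr rfl fun b _ => sum_comm
        _ = _ := sum_comm
    rw [h1, hW, card_filter]
    refine sum_le_sum fun k _ => ?_
    by_cases hk : piece k.castSucc = piece k.succ
    · rw [if_pos hk]
      obtain ⟨b, hb⟩ := exists_pieceStep_lt d v ε S x y θ p piece hS hθ hdom hne hcert k hk
      have hb' : f b k.castSucc < f b k.succ := by simp only [hf]; rw [← hk]; exact hb
      have hjP : piece k.castSucc ∈ range P := mem_range.mpr (hP _)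
      calc (1 : ℕ) = (if piece k.castSucc = piece k.succ ∧ piece k.castSucc = piece k.castSucc ∧
              f b k.castSucc < f b k.succ then 1 else 0) := by rw [if_pos ⟨hk, rfl, hb'⟩]
        _ ≤ ∑ j ∈ range P, (if piece k.castSucc = piece k.succ ∧ piece k.castSucc = j ∧
              f b k.castSucc < f b k.succ then 1 else 0) :=
          single_le_sum (f := fun j => if piece k.castSucc = piece k.succ ∧ piece k.castSucc = j ∧
              f b k.castSucc < f b k.succ then 1 else 0) (fun _ _ => Nat.zero_le _) hjP
        _ ≤ ∑ b : Fin m, ∑ j ∈ range P, (if piece k.castSucc = piece k.succ ∧ piece k.castSucc = j ∧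
              f b k.castSucc < f b k.succ then 1 else 0) :=
          single_le_sum (f := fun b => ∑ j ∈ range P, (if piece k.castSucc = piece k.succ ∧ piece k.castSucc = j ∧
              f b k.castSucc < f b k.succ then 1 else 0)) (fun _ _ => Nat.zero_le _) (mem_univ b)
    · rw [if_neg hk]
      exact Nat.zero_le _
  -- (c) per column and piece: at most `C − 1` strict rises
  have hRle : ∀ b j, R b j ≤ C - 1 := by
    intro b j
    rw [hR]
    generalize hRs : (univ.filter fun k : Fin n =>
      piece k.castSucc = piece k.succ ∧ piece k.castSucc = j ∧ f b k.castSucc < f b k.succ) = Rs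
    have hmemRs : ∀ k : Fin n, k ∈ Rs →
        piece k.castSucc = piece k.succ ∧ piece k.castSucc = j ∧ f b k.castSucc < f b k.succ := by
      intro k hk
      rw [← hRs] at hk
      exact (mem_filter.mp hk).2
    rcases Rs.eq_empty_or_nonempty with h0 | hne0
    · rw [h0, card_empty]; exact Nat.zero_le _
    · -- the least rise index of this piece; its start value is never hit by a later rise
      obtain ⟨k₀, hk₀, hmin⟩ := Rs.exists_min_image (fun k => (k : ℕ)) hne0
      have hk₀' := hmemRs k₀ hk₀
      have hle : Rs.card ≤ ((T j).erase (f b k₀.castSucc)).card := by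
        refine card_le_card_of_injOn (fun k : Fin n => f b k.succ) (fun k hk => ?_) (fun k hk k' hk' hkk' => ?_)
        · have hk2 := hmemRs k (mem_coe.mp hk)
          have hk0k : (k₀ : ℕ) ≤ (k : ℕ) := hmin k (mem_coe.mp hk)
          have hm : f b k₀.castSucc ≤ f b k.castSucc := hmono b _ _ (Fin.le_def.mpr (by
            simp only [Fin.val_castSucc]; exact hk0k)) (by rw [hk₀'.2.1, hk2.2.1])
          have hval : f b k.succ ∈ T j := by rw [← hk2.2.1, hk2.1]; exact hmem b _
          have hne1 : f b k.succ ≠ f b k₀.castSucc := by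
            intro h; rw [h] at hk2; exact absurd hk2.2.2 (not_lt.mpr hm)
          exact mem_coe.mpr (mem_erase.mpr ⟨hne1, hval⟩)
        · have e : f b k.succ = f b k'.succ := hkk'
          have hk2 := hmemRs k (mem_coe.mp hk)
          have hk2' := hmemRs k' (mem_coe.mp hk')
          by_contra hne'
          rcases lt_or_gt_of_ne hne' with hlt | hlt
          · have hv : (k : ℕ) < (k' : ℕ) := Fin.lt_def.mp hlt
            have h1 : f b k.succ ≤ f b k'.castSucc := hmono b _ _ (by
                rw [Fin.le_iff_val_le_val]; simp only [Fin.val_succ, Fin.val_castSucc]; omega)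
              (by rw [← hk2.1, hk2.2.1, hk2'.2.1])
            exact absurd e (ne_of_lt (lt_of_le_of_lt h1 hk2'.2.2))
          · have hv : (k' : ℕ) < (k : ℕ) := Fin.lt_def.mp hlt
            have h1 : f b k'.succ ≤ f b k.castSucc := hmono b _ _ (by
                rw [Fin.le_iff_val_le_val]; simp only [Fin.val_succ, Fin.val_castSucc]; omega)
              (by rw [← hk2'.1, hk2'.2.1, hk2.2.1])
            exact absurd e.symm (ne_of_lt (lt_of_le_of_lt h1 hk2.2.2))
      have hT0 : f b k₀.castSucc ∈ T j := by rw [← hk₀'.2.1]; exact hmem b _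
      have := card_erase_of_mem hT0
      have := hC j
      omega
  -- (d) assemble
  have hsum : ∑ b : Fin m, ∑ j ∈ range P, R b j ≤ m * (P * (C - 1)) := by
    calc ∑ b : Fin m, ∑ j ∈ range P, R b j ≤ ∑ _b : Fin m, ∑ _j ∈ range P, (C - 1) :=
          sum_le_sum fun b _ => sum_le_sum fun j _ => hRle b j
      _ = m * (P * (C - 1)) := by simp
  have hW' : W.card ≤ m * (P * (C - 1)) := hWle.trans hsum
  nlinarith [hWX, hXle, hW', hP0]

/-- **PIECEWISE AFFINE-DUAL LAW: `n + 1 ≤ P·(K·m² − m + 1)`.**  A chain of unique optima at strictly increasing integer slopes with distinct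
consecutive terms, certified column-wise on each of `P` consecutive pieces by a row potential affine in the slope, has fewer than
`P·(K·m² − m + 1)` terms — whatever the design; `P = 1` is `chain_le_of_affineCert`. [folklore] -/
theorem chain_le_of_piecewiseAffineCert : n + 1 ≤ P * (K * m ^ 2 - m + 1) := by
  classical
  have h := chain_le_of_piecewiseAffineCert_card d v ε S P x y θ p piece hS hθ hdom hne hP hpm hcert (m * K)
    (fun j => (univ : Finset (Fin m × Fin K)).image fun al => S * (d al.2 : ℤ) + x j al.1)
    (fun j a l => mem_image.mpr ⟨(a, l), mem_univ _, rfl⟩)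
    (fun j => card_image_le.trans (by simp))
  have e : m * (m * K - 1) + 1 = K * m ^ 2 - m + 1 := by
    rcases Nat.eq_zero_or_pos m with hm | hm
    · subst hm; simp
    rcases Nat.eq_zero_or_pos K with hK | hK
    · subst hK; simp
    have h1 : 1 ≤ m * K := Nat.one_le_iff_ne_zero.mpr (Nat.mul_ne_zero (by omega) (by omega))
    have h2 : m * (m * K - 1) = m * (m * K) - m := by rw [Nat.mul_sub, mul_one]
    have h3 : m ≤ m * (m * K) := Nat.le_mul_of_pos_right _ (by positivity)
    rw [h2]
    have : m * (m * K) = K * m ^ 2 := by ring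
    omega
  rw [← e]; exact h

end Pieces

end AffineDual

end Summit.ValiantsHypothesis.ValiantsHypothesis.Theorems.KPlusLogSqLaw
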